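import Mathlib.Analysis.SpecialFunctions.SmoothTransition
import Mathlib.Analysis.InnerProductSpace.Calculus
import Mathlib.Analysis.InnerProductSpace.PiL2
import Mathlib.Analysis.Calculus.InverseFunctionTheorem.ContDiff
import Mathlib.Analysis.Calculus.Deriv.Slope
import Mathlib.Analysis.SpecialFunctions.Sqrt
import Mathlib.Analysis.SpecialFunctions.Pow.Real
import Mathlib.Algebra.Order.Archimedean.Basic
import Mathlib.Topology.Order.IntermediateValue
import HarnessLib

/-!
# SmoothPoincare4 / CongruenceShadows — `GriffithsHandlebodyExtension` (item stmt-SmoothPoincare4-15190): the homothety-cover core, I — data and maps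

Support file (`--supports` stmt-SmoothPoincare4-15190) for the genus-one clause of Griffiths' handlebody
extension theorem in its extension form (E) — *every self-diffeomorphism `τ` of the Heegaard torus
`∂V` of the round solid torus fixing the base point and acting trivially on `π₁(∂V)` extends to a
self-diffeomorphism of `V`* (hypothesis `hE` of
`Literature.Topology.FourManifolds.RoundSolidTorusModel.diffeoExtends_of_map_ker_eq_ker_of_forall_diffeoExtends`,
`TorusMappingClassFaithfulModel.lean` §3, from which `griffithsExtension_genus_one_of_forall_diffeoExtends`
gives genus one of `Literature.Topology.FourManifolds.GriffithsExtension`, i.e. of this item).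

**The homothety-cover line** (prover c3 plan, item evidence `PLAN-GriffithsGenusOne-HomothetyCover.md`)
proves (E) three-dimensionally and WITHOUT curve-isotopy theory (no Baer/Epstein, no Dehn's lemma):
the universal cover of the solid torus is modelled as the punctured closed half-space
`H³ ∖ 0 = {(Y, t) ∈ ℝ² × ℝ : t ≥ 0} ∖ {0}` with deck transformation the homothety `δ_λ (p) = λ p`
(`λ > 1`); its boundary `ℝ² ∖ 0 → ∂V` is the covering of the torus for the meridian subgroup
`ker (π₁ ∂V → π₁ V)`, so a based `π₁`-trivial `τ` lifts to a `δ_λ`-equivariant diffeomorphism `τ̂` of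
`ℝ² ∖ 0`.  The lifted meridians `τ̂ {‖y‖ = c}` bound the explicit, pairwise disjoint, `δ_λ`-equivariant
family of GRAPH DISCS `Δ^(c) = {(Y, f c Y) : ρ Y ≤ c}`, `ρ = ‖τ̂⁻¹‖`, `f c Y = c − ρ(Y) χ(ρ(Y)/c)`, which
foliate `H³ ∖ 0` and play the role of the meridian discs for `τ` (this replaces the disc lemma).
Matching them with the cone foliation `{c · S²₊}` of the standard picture through a log-periodic
planar family `ẽ_c` (with `ẽ_c = δ_c⁻¹ τ̂ δ_c` on the unit circle and `ẽ_c (D̄) = δ_c⁻¹ τ̂ (D̄)`)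
yields an equivariant self-diffeomorphism `Ψ̂ = L ∘ M ∘ α⁻¹` of `H³ ∖ 0` restricting to `τ̂` on the
boundary plane; it descends to the required extension of `τ` over `V`.

This file and its three sequels (`…CoverProfile`, `…CoverCharts`, `…CoverCore`) formalise the
EUCLIDEAN CORE of that argument — everything that happens in `ℝ² × ℝ`, from Mathlib alone:

* `HomothetyCover.CoreData` — the input: `λ > 1`, `R₁ > 1`, the lifted diffeomorphism `τ̂ : ℝ² → ℝ²`
  (extended by `0 ↦ 0`) with its inverse `τ̂'`, smooth off `0` and `δ_λ`-equivariant, and the planar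
  family `ẽ : ℝ → ℝ² → ℝ²` with fibrewise inverses `ẽ'`, jointly smooth on `(0, ∞) × {‖u‖ < R₁}`,
  log-periodic (`ẽ_{λc} = ẽ_c`), equal to `δ_c⁻¹ τ̂ δ_c` on the unit circle, with
  `ẽ_c(D̄) = {w : w = 0 ∨ ‖τ̂'(c w)‖ ≤ c}`;
* the maps of the construction: `ρ`, the cut-off `χ`, the leaf height `f`, the cone chart `α` with
  its inverse `αinv` (radius `rad` and stereographic coordinate), the leaf chart `L (c, Y) = (Y, f c Y)`
  with its inverse `Linv` on `L(U)`, `U = {c > 0}`, the rescaling `M (c, u) = (c, c • ẽ_c u)` with its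
  inverse `M'`, and finally `Ψ = L ∘ M ∘ αinv`, `Ψ' = α ∘ M' ∘ Linv`.

The theorem is `HomothetyCover.CoreData.core` (`…CoverCore.lean`): `Ψ` is a bijection of `H³ ∖ 0`
with inverse `Ψ'`, both `C^∞` near `H³ ∖ 0`, `Ψ (λ p) = λ Ψ p`, and `Ψ (y, 0) = (τ̂ y, 0)`.  The
remaining steps of the line (the covering `H³ ∖ 0 → RoundSolidTorus`, the lift `τ̂`, the planar
family `ẽ` from planar Schoenflies + isotopy extension + Smale's theorem, and the descent) supply a
`CoreData` and read the extension off `core`; they are not in these files.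

## Design notes

* Pure definitions here (review-queued); all lemmas are in the sequels.  `E2 = EuclideanSpace ℝ (Fin 2)`
  (inner-product norm, so that `‖·‖` is smooth off `0`); points of space are pairs `ℝ² × ℝ`.
* `τ̂`, `τ̂'`, `ẽ_c`, `ẽ'_c` are total functions; only their values where the hypotheses speak are
  used.  `Linv` is `Function.invFunOn` (junk off `L(U)`), `Ψ'` inherits that junk off `H³ ∖ 0`.
* Nothing here is a named fact or cites a source: the construction is this seat's (prover c3,
  2026-08-16); the classical inputs enter only in the sequel steps of the line.
-/

-- the registered namespace `Summit.SmoothPoincare4.SmoothPoincare4.Theorems` repeats a component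
set_option linter.dupNamespace false

noncomputable section

namespace Summit.SmoothPoincare4.SmoothPoincare4.Theorems

namespace HomothetyCover

open Set Function Metric Filter
open scoped Topology ContDiff

/-- The plane `ℝ²`. -/
abbrev E2 : Type := EuclideanSpace ℝ (Fin 2)

/-- The punctured closed upper half-space `H³ ∖ {0} = {(Y, t) : t ≥ 0, (Y, t) ≠ 0}`. -/
def Hpunct : Set (E2 × ℝ) := {p | 0 ≤ p.2 ∧ p ≠ 0}

/-- **Input data of the homothety-cover core.**  `lam = λ > 1` is the deck homothety ratio and
`R₁ > 1` the radius of the open disc on which the planar family is controlled.  `τ, τ'` are the lift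
`τ̂ : ℝ² ∖ 0 ≅ ℝ² ∖ 0` of the boundary diffeomorphism and its inverse, extended by `0 ↦ 0`: mutually
inverse bijections of the plane, `C^∞` off the origin (`τ'`; the smoothness of `τ` itself is not
needed), with `τ̂ ∘ δ_λ = δ_λ ∘ τ̂`.  `e c = ẽ_c` (`c > 0`) is the planar family with fibrewise left
inverses `e' c`: jointly `C^∞` in `(c, u)` for `‖u‖ < R₁`, log-periodic `ẽ_{λc} = ẽ_c`, equal to
`δ_c⁻¹ τ̂ δ_c` on the unit circle, and mapping the closed unit disc onto
`δ_c⁻¹ (τ̂ (D̄ ∖ 0)) ∪ {0} = {w : w = 0 ∨ ‖τ̂' (c w)‖ ≤ c}`. -/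
structure CoreData where
  /-- the homothety ratio `λ` of the deck transformation `p ↦ λ p` -/
  lam : ℝ
  /-- `λ > 1` -/
  one_lt_lam : 1 < lam
  /-- radius of the disc on which the planar family `ẽ` is controlled -/
  R₁ : ℝ
  /-- `R₁ > 1` -/
  one_lt_R₁ : 1 < R₁
  /-- the lifted boundary diffeomorphism `τ̂` (extended by `0 ↦ 0`) -/
  τ : E2 → E2
  /-- its inverse `τ̂⁻¹` (extended by `0 ↦ 0`) -/
  τ' : E2 → E2
  /-- `τ̂ 0 = 0` -/
  τ_zero : τ 0 = 0
  /-- `τ̂⁻¹ 0 = 0` -/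
  τ'_zero : τ' 0 = 0
  /-- `τ̂⁻¹` is smooth off the origin -/
  contDiffAt_τ' : ∀ y, y ≠ 0 → ContDiffAt ℝ ∞ τ' y
  /-- `τ̂⁻¹ ∘ τ̂ = id` -/
  τ'_τ : ∀ y, τ' (τ y) = y
  /-- `τ̂ ∘ τ̂⁻¹ = id` -/
  τ_τ' : ∀ y, τ (τ' y) = y
  /-- `τ̂` commutes with the deck homothety -/
  τ_smul : ∀ y, τ (lam • y) = lam • τ y
  /-- the planar family `ẽ_c = e c` -/
  e : ℝ → E2 → E2
  /-- its fibrewise left inverses `ẽ'_c = e' c` -/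
  e' : ℝ → E2 → E2
  /-- `(c, u) ↦ ẽ_c u` is smooth on `(0, ∞) × {‖u‖ < R₁}` -/
  contDiffAt_e : ∀ c, 0 < c → ∀ u : E2, ‖u‖ < R₁ → ContDiffAt ℝ ∞ (uncurry e) (c, u)
  /-- `ẽ'_c ∘ ẽ_c = id` on `{‖u‖ < R₁}` -/
  e'_e : ∀ c, 0 < c → ∀ u : E2, ‖u‖ < R₁ → e' c (e c u) = u
  /-- `(c, w) ↦ ẽ'_c w` is smooth at the points `(c, ẽ_c u)`, `‖u‖ < R₁` -/
  contDiffAt_e' : ∀ c, 0 < c → ∀ u : E2, ‖u‖ < R₁ → ContDiffAt ℝ ∞ (uncurry e') (c, e c u)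
  /-- log-periodicity `ẽ_{λc} = ẽ_c` -/
  e_per : ∀ c, 0 < c → ∀ u : E2, ‖u‖ < R₁ → e (lam * c) u = e c u
  /-- on the unit circle `ẽ_c = δ_c⁻¹ ∘ τ̂ ∘ δ_c` -/
  e_sphere : ∀ c, 0 < c → ∀ u : E2, ‖u‖ = 1 → e c u = c⁻¹ • τ (c • u)
  /-- `ẽ_c` maps the closed unit disc onto `δ_c⁻¹ (τ̂ (D̄ ∖ 0)) ∪ {0}` -/
  e_image : ∀ c, 0 < c → e c '' closedBall (0 : E2) 1 = {w | w = 0 ∨ ‖τ' (c • w)‖ ≤ c}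

namespace CoreData

variable (D : CoreData)

/-- `ρ Y = ‖τ̂⁻¹ Y‖`: its level sets are the lifted meridians `τ̂ {‖y‖ = c}`. -/
def ρ (Y : E2) : ℝ := ‖D.τ' Y‖

/-- The cut-off `χ(r) = smoothTransition (4r − 1)`: `0` for `r ≤ 1/4`, `1` for `r ≥ 1/2`, monotone. -/
def χ (r : ℝ) : ℝ := Real.smoothTransition (4 * r - 1)

/-- The leaf height `f c Y = c − ρ(Y) χ(ρ(Y)/c)`: the leaf `Δ^(c)` is the graph of `f c` over
`{ρ ≤ c}`. -/
def f (c : ℝ) (Y : E2) : ℝ := c - D.ρ Y * χ (D.ρ Y / c)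

end CoreData

/-- `α (c, u) = c · σ(u)`, `σ` the inverse stereographic projection from the south pole:
`σ(u) = (2u, 1 − ‖u‖²)/(1 + ‖u‖²)`; `σ` maps the closed unit disc onto the closed upper hemisphere
and the unit circle identically onto the equator. -/
def α (q : ℝ × E2) : E2 × ℝ :=
  ((2 * q.1 / (1 + ‖q.2‖ ^ 2)) • q.2, q.1 * (1 - ‖q.2‖ ^ 2) / (1 + ‖q.2‖ ^ 2))

/-- The Euclidean norm `‖(Y, t)‖ = √(‖Y‖² + t²)` of a point of `ℝ² × ℝ`. -/
def rad (p : E2 × ℝ) : ℝ := Real.sqrt (‖p.1‖ ^ 2 + p.2 ^ 2)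

/-- The inverse chart `α⁻¹ (Y, t) = (r, Y/(r + t))`, `r = ‖(Y, t)‖` (radius and stereographic
coordinate), defined off the closed lower axis `{Y = 0, t ≤ 0}`. -/
def αinv (p : E2 × ℝ) : ℝ × E2 := (rad p, (rad p + p.2)⁻¹ • p.1)

namespace CoreData

variable (D : CoreData)

/-- `L (c, Y) = (Y, f c Y)`: leaf parameter and base point to the point of `H³`. -/
def L (x : ℝ × E2) : E2 × ℝ := (x.2, D.f x.1 x.2)

/-- The half-space `{c > 0}` of leaf parameters. -/
def U : Set (ℝ × E2) := {x | 0 < x.1}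

/-- The inverse of `L` on `L(U)` (junk elsewhere). -/
def Linv : E2 × ℝ → ℝ × E2 := Function.invFunOn D.L U

/-- `M (c, u) = (c, c • ẽ_c u)`. -/
def M (x : ℝ × E2) : ℝ × E2 := (x.1, x.1 • D.e x.1 x.2)

/-- The fibrewise inverse `M' (c, Y) = (c, ẽ'_c (c⁻¹ • Y))` of `M`. -/
def M' (x : ℝ × E2) : ℝ × E2 := (x.1, D.e' x.1 (x.1⁻¹ • x.2))

/-- **The equivariant extension** `Ψ̂ = L ∘ M ∘ α⁻¹`; explicitly
`Ψ̂ (Y, t) = (r • ẽ_r (Y/(r+t)), f r (r • ẽ_r (Y/(r+t))))`, `r = ‖(Y, t)‖`. -/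
def Ψ : E2 × ℝ → E2 × ℝ := D.L ∘ D.M ∘ αinv

/-- The inverse `Ψ̂⁻¹ = α ∘ M' ∘ L⁻¹` (on `H³ ∖ 0`). -/
def Ψ' : E2 × ℝ → E2 × ℝ := α ∘ D.M' ∘ D.Linv

end CoreData

end HomothetyCover

end Summit.SmoothPoincare4.SmoothPoincare4.Theorems

end
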